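import Summits.BirchSwinnertonDyer.BirchSwinnertonDyer.Theorems.EisensteinPrimesMazurMCOnCellBTwistbackSubrowDatumTwistStep
import Summits.BirchSwinnertonDyer.Rank1Residual.X2.ResidualLineCharacters
import Literature.NumberTheory.EllipticCurves.QuadraticTwistJInvariantProofs
import Literature.NumberTheory.EllipticCurves.QuadraticTwistLocalPolynomialTwoProofs
import HarnessLib

/-!
# Crux 3 `MazurMCOnCellB` (stmt-BirchSwinnertonDyer-19033), line `twistback` v12 — lane ISO-4b:
# the sub-row datum COMES BACK from the admissible twist partner (the step of ISO-4a is an equivalence)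

Width seat bsd-line-x2-p1-w7 (gen 4), cell `bsd-eis` (run/shared/lean/pub/bsd-eis/), 2026-08-29; sequel of ISO-4a
(`…TwistbackSubrowDatumTwistStep`: the datum passes from `W` to the admissible twist `Wd`). HONEST FRAMING: TOOL
THEOREMS ONLY (no `def`, no named fact, no `sorry`); every input a tree THEOREM; `--supports`
stmt-BirchSwinnertonDyer-19033; closes no stub; no summit statement, no Mazur main conjecture, no BSD is proved for
any curve; 0 cells / labels / stubs / tiers move.

WHAT. Same data as ISO-4a (`W` globally minimal, multiplicative at `3`; `K` imaginary quadratic, `d_K` odd, Heegner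
for `N_W` and `3`; `Wd` a globally minimal model of `E^{(d_K)}`), but now the sub-row datum is GIVEN AT `Wd` and
RECOVERED AT `W` (`subrowDatum_of_twist`). The asymmetry with ISO-4a: `K` is NOT Heegner for `N_{Wd}` (the primes of
`d_K` divide `N_{Wd}` and ramify), and the presentations of `Wd`'s line pull back to level `m_d·|d_K|` characters
of `W`'s line which are NOT primitive. The way round: take the PRIMITIVE presentations `(φ, ψ)` of the pulled-back
line `e(Φ₀ᵈ) ≤ W[3]` from Kronecker–Weber (`X2.ResidualLineCharacters.exists_character_sub/quot`), push them forward
by ISO-4a's dictionary to PRIMITIVE presentations `(φχ̄_K, ψχ̄_K)` of `Φ₀ᵈ`, and compare with the given ones by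
UNIQUENESS OF PRIMITIVE PRESENTATIONS (§1: two primitive Dirichlet characters inducing the same character of `Γ_ℚ`
have the same level and the same values on `ℕ`). Then the balance comes back through «c(E^K) = c(E)» read from right
to left, the primes of `d_K` (bad for `Wd`, good for `W`) dropping out with zero contribution.

* §1 `apply_natCast_eq_of_isPrimitive_of_forall` — uniqueness of primitive presentations (values on `ℕ`);
  `zmod_eq_of_val_smul_eq` — a scalar on a non-zero `p`-torsion point is determined.
* §2 `exists_smul_eq_quadraticTwist_symm` — a model relation the other way: `C′ • W = Wd^{(d)}` from `C • Wd = W^{(d)}`.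
* §3 **`subrowDatum_of_twist`** — datum at `Wd` ⟹ datum at `W` (with ISO-4a's `subrowDatum_twist` the step is an equivalence).

References: [GreenbergVatsal2000] §2 Prop. (2.4) p. 22, p. 28, §3 (28) p. 42; [Washington1997] Ch. 3 (conductors,
primitive characters), Thm. 14.1; [SilvermanAEC2009] X.5 Cor. 5.4, VII.5 Prop. 5.1; [Cox2013] §1.C (1.17).
-/

set_option autoImplicit false

-- `Summit.BirchSwinnertonDyer.BirchSwinnertonDyer.…`: the summit and its single sub-problem share a name.
set_option linter.dupNamespace false

noncomputable section

open scoped Classical NumberTheorySymbols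

open WeierstrassCurve NumberField IsDedekindDomain Field DirichletCharacter
  Literature.NumberTheory.EllipticCurves Literature.NumberTheory.GaloisRepresentations
  Literature.NumberTheory.EllipticCurves.GreenbergVatsal2000
  Literature.NumberTheory.EllipticCurves.Rank1Residual
  Literature.NumberTheory.QuadraticFields Literature.NumberTheory.QuadraticFields.Quadratic
  Summit.BirchSwinnertonDyer.Rank1Residual Summit.BirchSwinnertonDyer.Rank1Residual.X2
  Summit.BirchSwinnertonDyer.BirchSwinnertonDyer.Theorems.EisensteinPrimesLineCharactersWeilRelation
  Summit.BirchSwinnertonDyer.BirchSwinnertonDyer.Theorems.EisensteinPrimesMazurMCOnCellBTwistbackTwistLineCharacters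
  Summit.BirchSwinnertonDyer.BirchSwinnertonDyer.Theorems.EisensteinPrimesMazurMCOnCellBTwistbackTwistLineCharactersPackage
  Summit.BirchSwinnertonDyer.BirchSwinnertonDyer.Theorems.EisensteinPrimesMazurMCOnCellBTwistbackQuadraticRadical
  Summit.BirchSwinnertonDyer.BirchSwinnertonDyer.Theorems.EisensteinPrimesMazurMCOnCellBTwistbackTwistLocalBalance
  Summit.BirchSwinnertonDyer.BirchSwinnertonDyer.Theorems.EisensteinPrimesMazurMCOnCellBTwistbackTwistDoor
  Summit.BirchSwinnertonDyer.BirchSwinnertonDyer.Theorems.EisensteinPrimesLocalBalanceAtGoodPlace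
  Summit.BirchSwinnertonDyer.BirchSwinnertonDyer.Theorems.EisensteinPrimesMazurMCOnCellBTwistbackSubrowDatumCanonical
  Summit.BirchSwinnertonDyer.BirchSwinnertonDyer.Theorems.EisensteinPrimesMazurMCOnCellBTwistbackSubrowDatumTwistStep

namespace Summit.BirchSwinnertonDyer.BirchSwinnertonDyer.Theorems.EisensteinPrimesMazurMCOnCellBTwistbackSubrowDatumTwistBack

/-! ## §1. Uniqueness of primitive presentations; scalars on a point -/

/-- **Uniqueness of primitive presentations (values).** If `θ₁` mod `n₁` and `θ₂` mod `n₂` are PRIMITIVE Dirichlet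
characters with values in `𝔽_p` inducing the same character of `Γ_ℚ` (`θ₁(χ_{n₁}σ) = θ₂(χ_{n₂}σ)` for all `σ`),
then `n₁ = n₂` and `θ₁(a) = θ₂(a)` for every `a : ℕ`: their lifts to level `n₁n₂` agree (the cyclotomic character
is onto), so the conductors agree, and a natural number is a unit mod `n₁` iff mod `n₂`.
[cite: Washington1997, Ch. 3 (conductor; primitive characters)] -/
theorem apply_natCast_eq_of_isPrimitive_of_forall {p : ℕ} {n₁ n₂ : ℕ} [NeZero n₁] [NeZero n₂]
    {θ₁ : DirichletCharacter (ZMod p) n₁} {θ₂ : DirichletCharacter (ZMod p) n₂}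
    (h₁ : θ₁.IsPrimitive) (h₂ : θ₂.IsPrimitive)
    (h : ∀ σ : absoluteGaloisGroup ℚ,
      θ₁ ((modNCyclotomicCharacter ℚ n₁ σ : (ZMod n₁)ˣ) : ZMod n₁) =
        θ₂ ((modNCyclotomicCharacter ℚ n₂ σ : (ZMod n₂)ˣ) : ZMod n₂)) :
    n₁ = n₂ ∧ ∀ a : ℕ, θ₁ (a : ZMod n₁) = θ₂ (a : ZMod n₂) := by
  -- the two lifts to level `n₁ n₂` agree, hence so do the conductors
  have key : ∀ {k₁ k₂ : ℕ} [NeZero k₁] [NeZero k₂] (η₁ : DirichletCharacter (ZMod p) k₁)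
      (η₂ : DirichletCharacter (ZMod p) k₂),
      (∀ σ : absoluteGaloisGroup ℚ,
        η₁ ((modNCyclotomicCharacter ℚ k₁ σ : (ZMod k₁)ˣ) : ZMod k₁) =
          η₂ ((modNCyclotomicCharacter ℚ k₂ σ : (ZMod k₂)ˣ) : ZMod k₂)) →
      haveI : NeZero (k₁ * k₂) := ⟨mul_ne_zero (NeZero.ne k₁) (NeZero.ne k₂)⟩
      changeLevel (dvd_mul_right k₁ k₂) η₁ = changeLevel (dvd_mul_left k₂ k₁) η₂ := by
    intro k₁ k₂ _ _ η₁ η₂ hη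
    haveI : NeZero (k₁ * k₂) := ⟨mul_ne_zero (NeZero.ne k₁) (NeZero.ne k₂)⟩
    refine MulChar.ext fun x ↦ ?_
    obtain ⟨σ, hσ⟩ := modNCyclotomicCharacter_rat_surjective (k₁ * k₂) x
    rw [← hσ, changeLevel_apply_modNCyclotomicCharacter, changeLevel_apply_modNCyclotomicCharacter]
    exact hη σ
  haveI : NeZero (n₁ * n₂) := ⟨mul_ne_zero (NeZero.ne n₁) (NeZero.ne n₂)⟩
  have hAB := key θ₁ θ₂ h
  have hn : n₁ = n₂ :=
    calc n₁ = (changeLevel (dvd_mul_right n₁ n₂) θ₁).conductor := by rw [conductor_changeLevel]; exact h₁.symm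
      _ = (changeLevel (dvd_mul_left n₂ n₁) θ₂).conductor := by rw [hAB]
      _ = n₂ := by rw [conductor_changeLevel]; exact h₂
  subst hn
  have heq : θ₁ = θ₂ := changeLevel_injective (dvd_mul_right n₁ n₁) (key θ₁ θ₂ h)
  subst heq
  exact ⟨rfl, fun _ ↦ rfl⟩

/-- **A scalar on a non-zero `p`-torsion point is determined**: `a • P = b • P` (through `ZMod.val`) with `P ≠ 0`
forces `a = b` in `𝔽_p`. [folklore] -/
theorem zmod_eq_of_val_smul_eq {W : WeierstrassCurve ℚ} {p : ℕ} [hp : Fact p.Prime] {P : geomTorsion W (p : ℤ)}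
    (hP0 : P ≠ 0) {a b : ZMod p} (h : a.val • P = b.val • P) : a = b := by
  letI : Module (ZMod p) (geomTorsion W (p : ℤ)) := AddSubgroup.torsionBy.zmodModule
  haveI : NeZero p := ⟨hp.out.ne_zero⟩
  have hinj : Function.Injective fun c : ZMod p ↦ c • P := smul_left_injective (ZMod p) hP0
  refine hinj ?_
  change a • P = b • P
  rw [← ZMod.natCast_zmod_val a, ← ZMod.natCast_zmod_val b, Nat.cast_smul_eq_nsmul, Nat.cast_smul_eq_nsmul, h]

/-! ## §2. The model relation the other way -/

/-- **Untwisting is twisting**: from `C • Wd = W^{(d)}` (`d ≠ 0`) a change of variables `C′` with `C′ • W = Wd^{(d)}`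
(`(W^{(d)})^{(d)} ≅ W`, tree `exists_quadraticTwist_quadraticTwist_eq_smul`, and twisting commutes with changes of
variables, `quadraticTwist_smul`). [cite: SilvermanAEC2009, X.5 Cor. 5.4] -/
theorem exists_smul_eq_quadraticTwist_symm {W Wd : WeierstrassCurve ℚ} {d : ℚ} (hd : d ≠ 0)
    {C : VariableChange ℚ} (hC : C • Wd = W.quadraticTwist d) :
    ∃ C' : VariableChange ℚ, C' • W = Wd.quadraticTwist d := by
  obtain ⟨D, hD⟩ := exists_quadraticTwist_quadraticTwist_eq_smul W hd
  have hWd : Wd = C⁻¹ • W.quadraticTwist d := by rw [← hC, inv_smul_smul]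
  refine ⟨(⟨(C⁻¹).u, d * (C⁻¹).r, 0, 0⟩ : VariableChange ℚ) * D, ?_⟩
  rw [hWd, quadraticTwist_smul, hD, mul_smul]

/-! ## §3. The step back `E^{(d_K)} ↦ W` -/

/-- **THE SUB-ROW DATUM COMES BACK FROM THE ADMISSIBLE TWIST PARTNER.** `W` globally minimal, multiplicative at `3`;
`K` imaginary quadratic, `d_K` odd, Heegner for `N_W` and for `3`; `Wd` a globally minimal model of `E^{(d_K)}`. If
`(Wd, 3)` is on the sub-row (the registered datum, VERBATIM) then so is `(W, 3)`: line `e(Φ₀ᵈ)` with its Kronecker–Weber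
primitive presentations `(φ, ψ)`, whose push-forwards `(φχ̄_K, ψχ̄_K)` ARE the given presentations of `Φ₀ᵈ` by
uniqueness (§1), `S₀ = S₀ᵈ ∖ {v : ℓ_v ∣ d_K}` (canonical `S₀ᵈ` first), balance by «c(E^K) = c(E)» read backwards.
[cite: GreenbergVatsal2000, §2 Prop. (2.4) p. 22, p. 28 and §3 (28) p. 42] [cite: SilvermanAEC2009, X.5 Cor. 5.4 and VII.5 Prop. 5.1]
[cite: Washington1997, Thm. 14.1 and Ch. 3] -/
theorem subrowDatum_of_twist (W : WeierstrassCurve ℚ) [W.IsElliptic] [W.IsGloballyMinimal]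
    (K : Type) [Field K] [NumberField K] (hK : IsImaginaryQuadratic K) (hodd : Odd (NumberField.discr K))
    (hHN : SatisfiesHeegnerHypothesis (W.conductorNorm ℤ) K) (hH3 : SatisfiesHeegnerHypothesis 3 K)
    (Wd : WeierstrassCurve ℚ) [Wd.IsElliptic] [Wd.IsGloballyMinimal]
    (C : VariableChange ℚ) (hC : C • Wd = W.quadraticTwist (NumberField.discr K : ℚ))
    (hmult : W.HasMultiplicativeReductionAtPrime 3) (q : ℕ)
    (hD : q = 3 ∧ ¬ Wd.HasSplitMultiplicativeReductionAtPrime 3 ∧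
      ∃ (Φ₀ : AddSubgroup (geomTorsion Wd (3 : ℤ))) (m : ℕ) (_ : NeZero m) (φ : DirichletCharacter (ZMod 3) m)
        (d : ℕ) (_ : NeZero d) (ψ : DirichletCharacter (ZMod 3) d) (S₀ : Finset (HeightOneSpectrum (𝓞 ℚ))),
        IsRationalLine Wd 3 Φ₀ ∧ φ.IsPrimitive ∧ ψ.IsPrimitive ∧
        (∀ (σ : absoluteGaloisGroup ℚ), ∀ P ∈ Φ₀,
          σ • P = (φ ((modNCyclotomicCharacter ℚ m σ : (ZMod m)ˣ) : ZMod m)).val • P) ∧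
        (∀ (σ : absoluteGaloisGroup ℚ) (P : geomTorsion Wd (3 : ℤ)),
          σ • P - (ψ ((modNCyclotomicCharacter ℚ d σ : (ZMod d)ˣ) : ZMod d)).val • P ∈ Φ₀) ∧
        (∀ v ∈ S₀, ((3 : ℕ) : 𝓞 ℚ) ∉ v.asIdeal) ∧
        (∀ v : HeightOneSpectrum (𝓞 ℚ), v ∉ S₀ → ((3 : ℕ) : 𝓞 ℚ) ∉ v.asIdeal → Wd.HasGoodReductionAt v) ∧
        1 + ∑ v ∈ S₀, delta Wd 3 v =
          ∑ v ∈ S₀, ((if φ (Rat.HeightOneSpectrum.natGenerator v : ZMod m) =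
                (Rat.HeightOneSpectrum.natGenerator v : ZMod 3)
              then sFactor 3 (Rat.HeightOneSpectrum.natGenerator v) else 0) +
            (if ψ (Rat.HeightOneSpectrum.natGenerator v : ZMod d) =
                (Rat.HeightOneSpectrum.natGenerator v : ZMod 3)
              then sFactor 3 (Rat.HeightOneSpectrum.natGenerator v) else 0))) :
    q = 3 ∧ ¬ W.HasSplitMultiplicativeReductionAtPrime 3 ∧
      ∃ (Φ₀ : AddSubgroup (geomTorsion W (3 : ℤ))) (m : ℕ) (_ : NeZero m) (φ : DirichletCharacter (ZMod 3) m)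
        (d : ℕ) (_ : NeZero d) (ψ : DirichletCharacter (ZMod 3) d) (S₀ : Finset (HeightOneSpectrum (𝓞 ℚ))),
        IsRationalLine W 3 Φ₀ ∧ φ.IsPrimitive ∧ ψ.IsPrimitive ∧
        (∀ (σ : absoluteGaloisGroup ℚ), ∀ P ∈ Φ₀,
          σ • P = (φ ((modNCyclotomicCharacter ℚ m σ : (ZMod m)ˣ) : ZMod m)).val • P) ∧
        (∀ (σ : absoluteGaloisGroup ℚ) (P : geomTorsion W (3 : ℤ)),
          σ • P - (ψ ((modNCyclotomicCharacter ℚ d σ : (ZMod d)ˣ) : ZMod d)).val • P ∈ Φ₀) ∧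
        (∀ v ∈ S₀, ((3 : ℕ) : 𝓞 ℚ) ∉ v.asIdeal) ∧
        (∀ v : HeightOneSpectrum (𝓞 ℚ), v ∉ S₀ → ((3 : ℕ) : 𝓞 ℚ) ∉ v.asIdeal → W.HasGoodReductionAt v) ∧
        1 + ∑ v ∈ S₀, delta W 3 v =
          ∑ v ∈ S₀, ((if φ (Rat.HeightOneSpectrum.natGenerator v : ZMod m) =
                (Rat.HeightOneSpectrum.natGenerator v : ZMod 3)
              then sFactor 3 (Rat.HeightOneSpectrum.natGenerator v) else 0) +
            (if ψ (Rat.HeightOneSpectrum.natGenerator v : ZMod d) =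
                (Rat.HeightOneSpectrum.natGenerator v : ZMod 3)
              then sFactor 3 (Rat.HeightOneSpectrum.natGenerator v) else 0)) := by
  have hp2 : (3 : ℕ) ≠ 2 := by decide
  have h2 : Module.finrank ℚ K = 2 := hK.1
  have hDneg : NumberField.discr K < 0 := hK.discr_neg
  obtain ⟨hD4, hsqN⟩ := discr_emod_four_eq_one_and_squarefree_natAbs_of_odd h2 hodd
  haveI : NeZero (NumberField.discr K).natAbs := ⟨Int.natAbs_ne_zero.mpr hDneg.ne⟩
  have hpD : ¬ ((3 : ℕ) : ℤ) ∣ NumberField.discr K :=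
    Literature.SatisfiesHeegnerHypothesis.not_dvd_discr h2 hH3 Nat.prime_three dvd_rfl
  have hD0 : ((NumberField.discr K : ℤ) : ℚ) ≠ 0 := by exact_mod_cast hDneg.ne
  -- canonical `S₀ᵈ`: every place of `S₀ᵈ` is bad for `Wd`
  obtain ⟨hq, hnsd, Φd, md, _, φd, dd, _, ψd, Sd, hΦd, hφd, hψd, hφd0, hψd0, hS3, hgoodd, hbadd, hbald⟩ :=
    (subrowDatum_iff_canonical (W := Wd) q).mp hD
  -- the primes of `d_K` are good places `≠ 3` of `W`
  have hgoodD : ∀ v : HeightOneSpectrum (𝓞 ℚ), Rat.HeightOneSpectrum.natGenerator v ∣ (NumberField.discr K).natAbs →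
      ((3 : ℕ) : 𝓞 ℚ) ∉ v.asIdeal ∧ W.HasGoodReductionAt v := by
    intro v hvD
    have hvD' : ((Rat.HeightOneSpectrum.natGenerator v : ℕ) : ℤ) ∣ NumberField.discr K := Int.natCast_dvd.mpr hvD
    have hℓ3 : Rat.HeightOneSpectrum.natGenerator v ≠ 3 := fun h ↦ hpD (h ▸ hvD')
    refine ⟨fun h ↦ hℓ3 ((Nat.prime_dvd_prime_iff_eq (Rat.HeightOneSpectrum.prime_natGenerator v) Nat.prime_three).mp
      ((Rat.natCast_mem_asIdeal_iff v).mp h)), ?_⟩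
    refine hasGoodReductionAt_of_not_dvd_conductorNorm W v fun hvN ↦ ?_
    exact Literature.SatisfiesHeegnerHypothesis.not_dvd_discr h2 hHN (Rat.HeightOneSpectrum.prime_natGenerator v) hvN hvD'
  -- the Jacobi character of `K`, the radical, the identification `e : Wd[3] ≃ W[3]`
  obtain ⟨χ, hχ2, hχp, hχJ, hχrad⟩ := exists_quadraticChar_geomSqrt_of_emod_four (p := 3) hp2 hD4 hsqN
  obtain ⟨e, hpos, hneg, hpos', hneg', -, -⟩ :=
    exists_signEquiv_signs (W := W) (Wd := Wd) (p := 3) hp2 hDneg hpD C hC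
  -- the pulled-back line of `W` and its primitive presentations (Kronecker–Weber)
  set Φ₀ : AddSubgroup (geomTorsion W (3 : ℤ)) := Φd.map e.toAddMonoidHom with hΦ₀
  have hΦ : IsRationalLine W 3 Φ₀ := isRationalLine_map_signEquiv e _ hpos hneg hΦd
  obtain ⟨m, _, φ, hφ, -, hφ0⟩ := ResidualLineCharacters.exists_character_sub hΦ
  obtain ⟨d, _, ψ, hψ, -, hψ0⟩ := ResidualLineCharacters.exists_character_quot hΦ
  obtain ⟨hmD, hdD⟩ := coprime_level_of_good_off hΦ hφ hψ hφ0 hψ0 hgoodD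
  -- push forward: `Φ₀.map e⁻¹ = Φd` carries the PRIMITIVE `(φχ̄, ψχ̄)`
  have hback : Φ₀.map e.symm.toAddMonoidHom = Φd := by
    have hcomp : e.symm.toAddMonoidHom.comp e.toAddMonoidHom = AddMonoidHom.id _ :=
      AddMonoidHom.ext fun x ↦ e.symm_apply_apply x
    rw [hΦ₀, AddSubgroup.map_map, hcomp, AddSubgroup.map_id]
  have hprimφ' := isPrimitive_changeLevel_mul_changeLevel hφ hχp hmD
  have hprimψ' := isPrimitive_changeLevel_mul_changeLevel hψ hχp hdD
  have hφ0' : ∀ (σ : absoluteGaloisGroup ℚ), ∀ Q ∈ Φd, σ • Q =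
      ((changeLevel (dvd_mul_right m (NumberField.discr K).natAbs) φ *
          changeLevel (dvd_mul_left (NumberField.discr K).natAbs m) (χ.ringHomComp (Int.castRingHom (ZMod 3))) :
        DirichletCharacter (ZMod 3) (m * (NumberField.discr K).natAbs))
        ((modNCyclotomicCharacter ℚ (m * (NumberField.discr K).natAbs) σ :
          (ZMod (m * (NumberField.discr K).natAbs))ˣ) : ZMod (m * (NumberField.discr K).natAbs))).val • Q := by
    intro σ Q hQ
    exact smul_eq_twistChar_of_mem_map_symm e hpos hneg hD0 χ hχ2 hχrad φ hφ0 σ Q (hback ▸ hQ)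
  have hψ0' : ∀ (σ : absoluteGaloisGroup ℚ) (Q : geomTorsion Wd (3 : ℤ)), σ • Q -
      ((changeLevel (dvd_mul_right d (NumberField.discr K).natAbs) ψ *
          changeLevel (dvd_mul_left (NumberField.discr K).natAbs d) (χ.ringHomComp (Int.castRingHom (ZMod 3))) :
        DirichletCharacter (ZMod 3) (d * (NumberField.discr K).natAbs))
        ((modNCyclotomicCharacter ℚ (d * (NumberField.discr K).natAbs) σ :
          (ZMod (d * (NumberField.discr K).natAbs))ˣ) : ZMod (d * (NumberField.discr K).natAbs))).val • Q ∈ Φd := by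
    intro σ Q
    have h := smul_sub_twistChar_mem_map_symm e hpos hneg hD0 χ hχ2 hχrad Φ₀ ψ hψ0 σ Q
    rwa [hback] at h
  -- uniqueness of primitive presentations: values of `(φd, ψd)` are those of `(φχ̄, ψχ̄)`
  haveI : Finite Φd := Nat.finite_of_card_ne_zero (ne_of_eq_of_ne hΦd.1 (by decide))
  haveI : Nontrivial Φd := Finite.one_lt_card_iff_nontrivial.mp (lt_of_lt_of_eq (by decide) hΦd.1.symm)
  obtain ⟨⟨P, hPΦ⟩, hP⟩ := exists_ne (0 : Φd)
  have hP0 : P ≠ 0 := fun h ↦ hP (Subtype.ext h)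
  obtain ⟨-, hφval⟩ := apply_natCast_eq_of_isPrimitive_of_forall hφd hprimφ'
    (fun σ ↦ zmod_eq_of_val_smul_eq hP0 ((hφd0 σ P hPΦ).symm.trans (hφ0' σ P hPΦ)))
  obtain ⟨-, hψval⟩ := apply_natCast_eq_of_isPrimitive_of_forall hψd hprimψ' (fun σ ↦ by
    have h := EisensteinPrimesLinePsiAtMultiplicativePrime.natCast_eq_intCast_of_smul_sub_mem hΦd.1
      (s := ((((changeLevel (dvd_mul_right d (NumberField.discr K).natAbs) ψ *
          changeLevel (dvd_mul_left (NumberField.discr K).natAbs d) (χ.ringHomComp (Int.castRingHom (ZMod 3))) :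
        DirichletCharacter (ZMod 3) (d * (NumberField.discr K).natAbs))
        ((modNCyclotomicCharacter ℚ (d * (NumberField.discr K).natAbs) σ :
          (ZMod (d * (NumberField.discr K).natAbs))ˣ) : ZMod (d * (NumberField.discr K).natAbs))).val : ℕ) : ℤ))
      (fun Q ↦ by rw [natCast_zsmul]; exact hψ0' σ Q) (hψd0 σ)
    rwa [Int.cast_natCast, ZMod.natCast_zmod_val, ZMod.natCast_zmod_val] at h)
  -- the places of `d_K`, and the bad places of `W` inside `S₀ᵈ`
  obtain ⟨T, hT⟩ := exists_finset_forall_mem_iff_natGenerator_dvd (NumberField.discr K).natAbs (NeZero.ne _)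
  have hχ1 : ∀ v ∈ Sd \ T, χ (Rat.HeightOneSpectrum.natGenerator v : ZMod (NumberField.discr K).natAbs) = 1 ∧
      Rat.HeightOneSpectrum.natGenerator v ∣ W.conductorNorm ℤ := by
    intro v hv
    obtain ⟨hvS, hvT⟩ := Finset.mem_sdiff.mp hv
    have hvD : ¬ ((Rat.HeightOneSpectrum.natGenerator v : ℕ) : ℤ) ∣ NumberField.discr K :=
      fun h ↦ hvT ((hT v).mpr (Int.natCast_dvd.mp h))
    -- `v` is bad for `W`: otherwise `Wd` would be good at `v`
    have hbadW : ¬ W.HasGoodReductionAt v := fun hg ↦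
      hbadd v hvS (hasGoodReductionAt_of_smul_eq_quadraticTwist hD4 C hC v hvD hg)
    have hvN : Rat.HeightOneSpectrum.natGenerator v ∣ W.conductorNorm ℤ := (W.dvd_conductorNorm_iff v).mpr hbadW
    exact ⟨chi_natCast_eq_one_of_heegner' h2 hD4 hHN χ hχJ (Rat.HeightOneSpectrum.prime_natGenerator v) hvN, hvN⟩
  obtain ⟨C', hC'⟩ := exists_smul_eq_quadraticTwist_symm hD0 hC
  refine ⟨hq, fun hs ↦ hnsd ((hasSplitMultiplicativeReductionAtPrime_iff_of_smul_eq_quadraticTwist W Wd hK 3 hp2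
      hmult hH3 hC).mpr hs), Φ₀, m, inferInstance, φ, d, inferInstance, ψ, Sd \ T, hΦ, hφ, hψ, hφ0, hψ0,
    fun v hv ↦ hS3 v (Finset.sdiff_subset hv), ?_, ?_⟩
  · -- `W` is good off `(S₀ᵈ ∖ T) ∪ {3}`
    intro v hv h3
    by_cases hvT : v ∈ T
    · exact (hgoodD v ((hT v).mp hvT)).2
    · have hvS : v ∉ Sd := fun hvS ↦ hv (Finset.mem_sdiff.mpr ⟨hvS, hvT⟩)
      have hvD : ¬ ((Rat.HeightOneSpectrum.natGenerator v : ℕ) : ℤ) ∣ NumberField.discr K :=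
        fun h ↦ hvT ((hT v).mpr (Int.natCast_dvd.mp h))
      exact hasGoodReductionAt_of_smul_eq_quadraticTwist hD4 C' hC' v hvD (hgoodd v hvS h3)
  · -- the balance over `S₀ᵈ ∖ T` at `W`, from the balance over `S₀ᵈ = (S₀ᵈ ∖ T) ∪ (S₀ᵈ ∩ T)` at `Wd`
    have hunion : Sd \ T ∪ Sd ∩ T = Sd := Finset.sdiff_union_inter Sd T
    have hdisj : Disjoint (Sd \ T) (Sd ∩ T) :=
      Finset.disjoint_left.mpr fun v hv hv' ↦ (Finset.mem_sdiff.mp hv).2 (Finset.mem_inter.mp hv').2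
    have hTD : ∀ v ∈ Sd ∩ T, ((Rat.HeightOneSpectrum.natGenerator v : ℕ) : ℤ) ∣ NumberField.discr K :=
      fun v hv ↦ Int.natCast_dvd.mpr ((hT v).mp (Finset.mem_inter.mp hv).2)
    have hTcop : ∀ v ∈ Sd ∩ T, ¬ (Rat.HeightOneSpectrum.natGenerator v).Coprime (NumberField.discr K).natAbs :=
      fun v hv h ↦ (Nat.Prime.coprime_iff_not_dvd (Rat.HeightOneSpectrum.prime_natGenerator v)).mp h
        ((hT v).mp (Finset.mem_inter.mp hv).2)
    have hTp' : ∀ v ∈ Sd ∩ T, (Rat.HeightOneSpectrum.natGenerator v : ZMod 3) ≠ 0 := by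
      intro v hv h
      rw [ZMod.natCast_eq_zero_iff] at h
      have h3 : Rat.HeightOneSpectrum.natGenerator v = 3 :=
        ((Nat.prime_dvd_prime_iff_eq Nat.prime_three (Rat.HeightOneSpectrum.prime_natGenerator v)).mp h).symm
      exact (hgoodD v ((hT v).mp (Finset.mem_inter.mp hv).2)).1
        ((Rat.natCast_mem_asIdeal_iff v).mpr (h3 ▸ dvd_rfl))
    rw [← hunion] at hbald
    refine (balance_union_iff φ ψ φd ψd (Sd \ T) (Sd ∩ T) hdisj
      (fun v hv ↦ delta_twist_eq_of_heegner W K 3 h2 hHN v (hχ1 v hv).2 C hC)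
      (fun v hv ↦ delta_twist_eq_zero_of_dvd_discr W K 3 h2 v (hTD v hv)
        (hgoodD v ((hT v).mp (Finset.mem_inter.mp hv).2)).2 C hC)
      (fun v hv ↦ ?_) (fun v hv ↦ ?_) (fun v hv ↦ ?_) (fun v hv ↦ ?_) hTp' 1).mp hbald
    · rw [hφval, twistChar_natCast_of_apply_eq_one φ χ (hχ1 v hv).1]
    · rw [hψval, twistChar_natCast_of_apply_eq_one ψ χ (hχ1 v hv).1]
    · rw [hφval, twistChar_natCast_of_not_coprime φ χ (hTcop v hv)]
    · rw [hψval, twistChar_natCast_of_not_coprime ψ χ (hTcop v hv)]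

end Summit.BirchSwinnertonDyer.BirchSwinnertonDyer.Theorems.EisensteinPrimesMazurMCOnCellBTwistbackSubrowDatumTwistBack

end
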